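import Summits.HubbardSuperconductivity.HubbardSuperconductivity.Theorems.LiebTwinNoOnsiteODLROCouplingTransport
import HarnessLib

/-!
# Crux `NoOnsiteODLRO` (stmt-HubbardSuperconductivity-0933), line `Sketch` — EXPOSURE of the core stub
# `stub_reducedBCSStability`: it contains the crux for every MORE ATTRACTIVE model `H_U − (g'/L²)·P_sᴴP_s`

Helper file of lead c3 (route `LiebTwin`; the `EnslavedA1g` copy of the crux is `Iff.rfl`-equal), serving
`--supports stmt-HubbardSuperconductivity-0933`. The line `Lines/Sketch.lean` (idea `shastry-secant-reduced-bcs`)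
closes the crux from ONE open stub, `ReducedBCSStability` (RBS): for a fixed `g > 0` the sector-energy gain
`G_L(g) := E_K(H_U) − E_K(H_U − (g/L²)·P_sᴴP_s)` (`K = szSector N_L 0`) is `o(L²)`. This file records,
kernel-checked, what the CONVEXITY of `g ↦ G_L(g)` says about the logical strength of that stub:

* `gain_mono` — the gain is monotone in the channel strength: `G(c') ≤ G(c)` for `0 ≤ c' ≤ c`
  (`c·PᴴP − c'·PᴴP ⪰ 0`, Loewner monotonicity of sector energies). So RBS at `g` is RBS at every `g' ≤ g`.
* `smul_re_expect_le_gain_of_perturbedGround` — **supergradient at an interior point**: for every unit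
  ground eigenvector `ψ'` of the PERTURBED matrix `H − c'·PᴴP` in a sector `K` and every `c ≥ c'`,
  `(c − c')·Re⟨ψ', PᴴP ψ'⟩ ≤ E_K(H − c'·PᴴP) − E_K(H − c·PᴴP) ≤ E_K(H) − E_K(H − c·PᴴP) = G(c)` (the on-site
  secant of `Theorems.NoOnsiteODLRO.ReducedChannel` applied to `H − c'·PᴴP`, plus `gain_mono`).
* `reducedBCSStability_forces_perturbed_noOnsiteODLRO` — hence RBS (the registered stub, VERBATIM as
  hypothesis) implies: for all `U > 0`, `δ ∈ (0,1/2)` there is `g > 0` such that for EVERY `g' ∈ [0, g)` and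
  every admissible sequence of normalised sector ground states `ψ_L` of the `s`-wave-ATTRACTED repulsive
  Hubbard torus `hubbardTorus 2 L 1 U − (g'/L²)·P_sᴴP_s` at filling `N_L` (hypothesis block over nonzero
  sides `L`, where `pairField` lives), `S_L/L⁴ → 0` along even `L`.
  At `g' = 0` this is the crux itself (the skeleton's composition); for `g' > 0` it is the crux for a
  one-parameter family of Hamiltonians with an explicit uniform `s`-wave BCS attraction added — the stub is
  the crux INTEGRATED over `g' ∈ [0, g]` (`G_L(g) = ∫₀^g L⁻²·max_GS S_L(g') dg'`), never weaker than it.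

This is an exposure, not a refutation: physically the reduced `s`-channel of the doped repulsive model is
massive (threshold `g_c(U) > 0`, card §Why it bites (3), ED j025130), so RBS is expected TRUE for small `g`;
but no finite-`L` handle on `G_L` below `Θ(L²)` exists in the tree or the literature (STRATEGY-CENSUS T1–T5).
Sources: B. S. Shastry, J. Phys. A 30 (1997) L635, eq. (1); R. B. Griffiths, J. Math. Phys. 5 (1964) 1215,
§III (concavity/supergradients of ground energies); H. Tasaki, *Physics and Mathematics of Quantum Many-Body
Systems* (2020) §2.2. Folklore bookkeeping on tree definitions; no definition, no named fact.
-/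

noncomputable section

set_option linter.dupNamespace false

namespace Summit.HubbardSuperconductivity.HubbardSuperconductivity.Theorems.NoOnsiteODLRO.ReducedBCS

open Matrix Finset
open Literature.Probability.LatticeModels Literature.MathematicalPhysics.QuantumLattice
open Summit.HubbardSuperconductivity.HubbardSuperconductivity.Theorems.NoOnsiteODLRO.ReducedChannel
  (smul_re_expect_le_minEnergyOn_sub minEnergyOn_mono_of_posSemidef_sub)
open scoped ComplexOrder

/-! ### Abstract part: monotonicity of the gain and the interior supergradient -/

section Abstract

variable {n : Type*} [Fintype n] [DecidableEq n]

omit [DecidableEq n] in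
/-- `c • PᴴP` is Hermitian for real `c`. [folklore] -/
theorem isHermitian_real_smul_conjTranspose_mul_self (P : Matrix n n ℂ) (c : ℝ) :
    ((c : ℂ) • (Pᴴ * P)).IsHermitian := by
  unfold Matrix.IsHermitian
  rw [conjTranspose_smul, (isHermitian_conjTranspose_mul_self P).eq, Complex.star_def, Complex.conj_ofReal]

/-- **The gain is monotone in the channel strength**: for a Hermitian `H`, any `P`, a sector `K` and
`0 ≤ c' ≤ c`, `E_K(H − c·PᴴP) ≤ E_K(H − c'·PᴴP)` (the difference `(c − c')·PᴴP` is positive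
semidefinite; Loewner monotonicity `minEnergyOn_mono_of_posSemidef_sub`). Hence
`G(c') = E_K(H) − E_K(H − c'·PᴴP) ≤ G(c)`. Griffiths (1964) §III. [folklore] -/
theorem gain_mono {H : Matrix n n ℂ} (hH : H.IsHermitian) (P : Matrix n n ℂ) (K : Submodule ℂ (n → ℂ))
    {c' c : ℝ} (hc : c' ≤ c) :
    (H - (c : ℂ) • (Pᴴ * P)).minEnergyOn K ≤ (H - (c' : ℂ) • (Pᴴ * P)).minEnergyOn K := by
  have hB : (H - (c : ℂ) • (Pᴴ * P)).IsHermitian := hH.sub (isHermitian_real_smul_conjTranspose_mul_self P c)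
  refine minEnergyOn_mono_of_posSemidef_sub hB ?_ K
  have hdiff : H - (c' : ℂ) • (Pᴴ * P) - (H - (c : ℂ) • (Pᴴ * P)) = ((c - c' : ℝ) : ℂ) • (Pᴴ * P) := by
    rw [sub_sub_sub_cancel_left, ← sub_smul, ← Complex.ofReal_sub]
  rw [hdiff]
  exact (posSemidef_conjTranspose_mul_self P).smul (Complex.zero_le_real.2 (sub_nonneg.2 hc))

/-- **Supergradient at an interior point of Shastry's pencil.** For a Hermitian `H`, any `P`, a sector `K`,
couplings `c' ≤ c`, and a unit vector `ψ ∈ K` realising `E_K(H − c'·PᴴP)` (a ground state of the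
PERTURBED matrix), `(c − c')·Re⟨ψ, PᴴP ψ⟩ ≤ E_K(H − c'·PᴴP) − E_K(H − c·PᴴP)` (`ψ` is a trial state for
`H − c·PᴴP = (H − c'·PᴴP) − (c − c')·PᴴP`). Shastry (1997) eq. (1); Griffiths (1964) §III. [folklore] -/
theorem smul_re_expect_le_sub_of_perturbedGround {H : Matrix n n ℂ} (hH : H.IsHermitian) (P : Matrix n n ℂ)
    (K : Submodule ℂ (n → ℂ)) {c' c : ℝ} {ψ : n → ℂ} (hψK : ψ ∈ K) (hψ : star ψ ⬝ᵥ ψ = 1)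
    (hground : (star ψ ⬝ᵥ (H - (c' : ℂ) • (Pᴴ * P)) *ᵥ ψ).re = (H - (c' : ℂ) • (Pᴴ * P)).minEnergyOn K) :
    (c - c') * (star ψ ⬝ᵥ (Pᴴ * P) *ᵥ ψ).re ≤
      (H - (c' : ℂ) • (Pᴴ * P)).minEnergyOn K - (H - (c : ℂ) • (Pᴴ * P)).minEnergyOn K := by
  have hH' : (H - (c' : ℂ) • (Pᴴ * P)).IsHermitian :=
    hH.sub (isHermitian_real_smul_conjTranspose_mul_self P c')
  have h := smul_re_expect_le_minEnergyOn_sub hH' P (c - c') K hψK hψ hground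
  have hsplit : H - (c' : ℂ) • (Pᴴ * P) - ((c - c' : ℝ) : ℂ) • (Pᴴ * P) = H - (c : ℂ) • (Pᴴ * P) := by
    rw [sub_sub, ← add_smul, ← Complex.ofReal_add, add_sub_cancel]
  rw [hsplit] at h
  exact h

/-- **The interior supergradient against the FULL gain**: under the hypotheses of
`smul_re_expect_le_sub_of_perturbedGround` and `0 ≤ c'`,
`(c − c')·Re⟨ψ, PᴴP ψ⟩ ≤ E_K(H) − E_K(H − c·PᴴP) = G(c)` (add `gain_mono` at `0 ≤ c'`). So a sub-extensive
gain at `c` forces a small `PᴴP`-expectation in every ground state of every less-perturbed matrix.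
[folklore] -/
theorem smul_re_expect_le_gain_of_perturbedGround {H : Matrix n n ℂ} (hH : H.IsHermitian) (P : Matrix n n ℂ)
    (K : Submodule ℂ (n → ℂ)) {c' c : ℝ} (hc' : 0 ≤ c') {ψ : n → ℂ} (hψK : ψ ∈ K)
    (hψ : star ψ ⬝ᵥ ψ = 1)
    (hground : (star ψ ⬝ᵥ (H - (c' : ℂ) • (Pᴴ * P)) *ᵥ ψ).re = (H - (c' : ℂ) • (Pᴴ * P)).minEnergyOn K) :
    (c - c') * (star ψ ⬝ᵥ (Pᴴ * P) *ᵥ ψ).re ≤ H.minEnergyOn K - (H - (c : ℂ) • (Pᴴ * P)).minEnergyOn K := by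
  have h1 := smul_re_expect_le_sub_of_perturbedGround hH P K (c := c) hψK hψ hground
  have h2 := gain_mono hH P K hc'
  rw [Complex.ofReal_zero, zero_smul, sub_zero] at h2
  linarith

end Abstract

/-! ### The exposure of `stub_reducedBCSStability` -/

/-- **`ReducedBCSStability` contains the crux for the `s`-wave-attracted models.** Assume the registered core
stub of line `Sketch` (verbatim): for all `U > 0`, `δ ∈ (0,1/2)` some fixed `g > 0` has
`E(H_U) − E(H_U − (g/L²)·P_sᴴP_s) ≤ εL²` eventually in even `L` at filling `N_L = 2⌊(1−δ)L²/2⌋`. Then for the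
same `g`, EVERY `g' ∈ [0, g)` and every sequence `(N, ψ)` admissible for the perturbed Hamiltonian
`H' = hubbardTorus 2 L 1 U − (g'/L²)·P_sᴴP_s` (filling `N_L`, `ψ_L` a normalised `(N_L, 0)`-sector ground
state of `H'`), the on-site pair structure factor obeys `Re⟨ψ_L, P_sᴴP_s ψ_L⟩/L⁴ ≤ ε` eventually in even `L`,
for every `ε > 0` — i.e. `NoOnsiteODLRO` for the repulsive Hubbard torus with an ADDED uniform `s`-wave BCS
attraction of strength `g'/L²` (at `g' = 0`: the crux). Proof: the interior supergradient
`((g − g')/L²)·S_L ≤ G_L(g) ≤ ε(g − g')L²`. Shastry (1997) eq. (1); Griffiths (1964) §III. [folklore] -/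
theorem reducedBCSStability_forces_perturbed_noOnsiteODLRO
    (hRBS : ∀ (U δ : ℝ), 0 < U → δ ∈ Set.Ioo (0 : ℝ) (1 / 2) →
      ∃ g : ℝ, 0 < g ∧ ∀ ε : ℝ, 0 < ε → ∃ L₀ : ℕ, ∀ (L : ℕ) [NeZero L], Even L → L₀ ≤ L →
        (hubbardTorus 2 L 1 U).minEnergyOn
              (szSector (Λ := FermionTorus 2 L) (2 * ⌊(1 - δ) * (L : ℝ) ^ 2 / 2⌋₊) 0) -
            (hubbardTorus 2 L 1 U -
                ((g / (L : ℝ) ^ 2 : ℝ) : ℂ) • ((pairField sWave L)ᴴ * pairField sWave L)).minEnergyOn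
              (szSector (Λ := FermionTorus 2 L) (2 * ⌊(1 - δ) * (L : ℝ) ^ 2 / 2⌋₊) 0) ≤
          ε * (L : ℝ) ^ 2) :
    ∀ (U δ : ℝ), 0 < U → δ ∈ Set.Ioo (0 : ℝ) (1 / 2) →
      ∃ g : ℝ, 0 < g ∧ ∀ g' : ℝ, 0 ≤ g' → g' < g →
        ∀ (N : ℕ → ℕ) (ψ : ∀ L, Fock (Orb (FermionTorus 2 L))),
          (∀ (L : ℕ) [NeZero L], Even L → N L = 2 * ⌊(1 - δ) * (L : ℝ) ^ 2 / 2⌋₊ ∧ star (ψ L) ⬝ᵥ ψ L = 1 ∧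
              IsGroundStateInSector
                (hubbardTorus 2 L 1 U -
                  ((g' / (L : ℝ) ^ 2 : ℝ) : ℂ) • ((pairField sWave L)ᴴ * pairField sWave L))
                (N L) 0 (ψ L)) →
            ∀ ε : ℝ, 0 < ε → ∃ L₀ : ℕ, ∀ (L : ℕ) [NeZero L], Even L → L₀ ≤ L →
              (expect ((pairField sWave L)ᴴ * pairField sWave L) (ψ L)).re / (L : ℝ) ^ 4 ≤ ε := by
  intro U δ hU hδ
  obtain ⟨g, hg, hG⟩ := hRBS U δ hU hδ
  refine ⟨g, hg, fun g' hg'0 hg'g N ψ hyp ε hε => ?_⟩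
  have hgg : 0 < g - g' := sub_pos.2 hg'g
  obtain ⟨L₀, hL₀⟩ := hG (ε * (g - g')) (mul_pos hε hgg)
  refine ⟨L₀, fun L _ hEv hL => ?_⟩
  obtain ⟨hN, hψ1, hmem, -, heig⟩ := hyp L hEv
  have hgain := hL₀ L hEv hL
  rw [← hN] at hgain
  set P := pairField sWave L with hP
  set K := szSector (Λ := FermionTorus 2 L) (N L) 0 with hK
  have hH : (hubbardTorus 2 L 1 U).IsHermitian := LiebThm1.hamiltonian_isHermitian (fermionTorusGraph 2 L) 1 U
  have hL1 : (0 : ℝ) < (L : ℝ) := by exact_mod_cast Nat.pos_of_ne_zero (NeZero.ne L)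
  have hL2 : (0 : ℝ) < (L : ℝ) ^ 2 := by positivity
  have hL4 : (0 : ℝ) < (L : ℝ) ^ 4 := by positivity
  -- the perturbed ground state realises the perturbed sector energy
  have hground : (star (ψ L) ⬝ᵥ (hubbardTorus 2 L 1 U - ((g' / (L : ℝ) ^ 2 : ℝ) : ℂ) • (Pᴴ * P)) *ᵥ ψ L).re =
      (hubbardTorus 2 L 1 U - ((g' / (L : ℝ) ^ 2 : ℝ) : ℂ) • (Pᴴ * P)).minEnergyOn K := by
    rw [heig, dotProduct_smul, hψ1, smul_eq_mul, mul_one, Complex.ofReal_re]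
  have hc' : 0 ≤ g' / (L : ℝ) ^ 2 := div_nonneg hg'0 hL2.le
  have hsg := smul_re_expect_le_gain_of_perturbedGround hH P K (c := g / (L : ℝ) ^ 2) hc' hmem hψ1 hground
  -- `((g - g')/L²)·S ≤ G_L(g) ≤ ε (g - g') L²`, hence `S ≤ ε L⁴`
  set S := (star (ψ L) ⬝ᵥ (Pᴴ * P) *ᵥ ψ L).re with hS
  have hcoef : g / (L : ℝ) ^ 2 - g' / (L : ℝ) ^ 2 = (g - g') / (L : ℝ) ^ 2 := by ring
  rw [hcoef] at hsg
  have key : (g - g') / (L : ℝ) ^ 2 * S ≤ ε * (g - g') * (L : ℝ) ^ 2 := hsg.trans hgain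
  have key2 : (g - g') * S ≤ (g - g') * (ε * (L : ℝ) ^ 4) := by
    have h := mul_le_mul_of_nonneg_left key hL2.le
    calc (g - g') * S = (L : ℝ) ^ 2 * ((g - g') / (L : ℝ) ^ 2 * S) := by field_simp
      _ ≤ (L : ℝ) ^ 2 * (ε * (g - g') * (L : ℝ) ^ 2) := h
      _ = (g - g') * (ε * (L : ℝ) ^ 4) := by ring
  have hSle : S ≤ ε * (L : ℝ) ^ 4 := le_of_mul_le_mul_left key2 hgg
  change S / (L : ℝ) ^ 4 ≤ ε
  rw [div_le_iff₀ hL4]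
  exact hSle

/-! ### Registered helper stub -/

/-- **Registered helper stub `stub_reducedBCSExposure`** of crux `NoOnsiteODLRO` (stmt-HubbardSuperconductivity-0933,
line `Sketch`; NOT a composition piece): the core stub `stub_reducedBCSStability`, taken as a hypothesis verbatim,
forces `NoOnsiteODLRO` for every `s`-wave-attracted model `hubbardTorus 2 L 1 U − (g'/L²)·P_sᴴP_s`, `g' ∈ [0,g)`
(`reducedBCSStability_forces_perturbed_noOnsiteODLRO` with all binders after the colon). [folklore] -/
theorem stub_reducedBCSExposure : open Literature.MathematicalPhysics.QuantumLattice Literature.Probability.LatticeModels in (∀ (U δ : ℝ), 0 < U → δ ∈ Set.Ioo (0 : ℝ) (1 / 2) → ∃ g : ℝ, 0 < g ∧ ∀ ε : ℝ, 0 < ε → ∃ L₀ : ℕ, ∀ (L : ℕ) [NeZero L], Even L → L₀ ≤ L → (hubbardTorus 2 L 1 U).minEnergyOn (szSector (Λ := FermionTorus 2 L) (2 * ⌊(1 - δ) * (L : ℝ) ^ 2 / 2⌋₊) 0) - (hubbardTorus 2 L 1 U - ((g / (L : ℝ) ^ 2 : ℝ) : ℂ) • ((pairField sWave L)ᴴ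 * pairField sWave L)).minEnergyOn (szSector (Λ := FermionTorus 2 L) (2 * ⌊(1 - δ) * (L : ℝ) ^ 2 / 2⌋₊) 0) ≤ ε * (L : ℝ) ^ 2) → ∀ (U δ : ℝ), 0 < U → δ ∈ Set.Ioo (0 : ℝ) (1 / 2) → ∃ g : ℝ, 0 < g ∧ ∀ g' : ℝ, 0 ≤ g' → g' < g → ∀ (N : ℕ → ℕ) (ψ : ∀ L, Fock (Orb (FermionTorus 2 L))), (∀ (L : ℕ) [NeZero L], Even L → N L = 2 * ⌊(1 - δ) * (L : ℝ) ^ 2 / 2⌋₊ ∧ star (ψ L) ⬝ᵥ ψ L = 1 ∧ IsGroundStateInSector (hubbardTorus 2 L 1 U - ((g' / (L : ℝ) ^ 2 : ℝ) : ℂ) • ((pairField sWave L)ᴴ * pairField sWave L)) (N L) 0 (ψ L)) → ∀ ε : ℝ, 0 < ε → ∃ L₀ : ℕ, ∀ (L : ℕ) [NeZero L], Even L → L₀ ≤ L → (expect ((pairField sWave L)ᴴ * pairField sWave L) (ψ L)).re / (L : ℝ) ^ 4 ≤ ε :=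
  fun h => reducedBCSStability_forces_perturbed_noOnsiteODLRO h

end Summit.HubbardSuperconductivity.HubbardSuperconductivity.Theorems.NoOnsiteODLRO.ReducedBCS

end
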